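import Literature.NumberTheory.Automorphic.Liu2021.Def411WeilCarriersLocalTypesOfEquiv
import Literature.NumberTheory.Automorphic.Liu2021.LemD1AsPrintedIndexed
import Literature.NumberTheory.Automorphic.Liu2021.LemD1FamilyOfPlace
import HarnessLib

/-!
# [Liu2021, App. D §D.1]'s local data for the hermitian space `V` ITSELF at a finite place — the tree's local types of
# `ω(μ, ε, χ)` as `LemD1Data` over ONE standing data `U(J_V)(F_v)` — and the cross-`μ` separation `hμsep` from
# [Lem. D.1 (1), (3)] AS PRINTED read on the indexed collection of these data

Topic `NumberTheory/Automorphic/Liu2021`; namespace `Literature.NumberTheory.Automorphic.Liu2021.Def411WeilCarriers`.  Definitions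
with bodies (`epsLine`, `localLemD1DataAtV`, `quotEquivLocalType`, `localIndexedFamilyAtV`) and theorems; no named fact, no `sorry`; nothing
of [Liu2021] is asserted (Lemma D.1 enters only as the hypotheses `LemD1_1AsPrinted (…)` ∕ `LemD1_3AsPrintedI (…)` on the consumer's OWN data).

## What this file is, and why (the Δ2 bridge's cite leg `hμsep`, cell pub-hodgecm2)

[Liu2021, Thm. 4.18 (2)] («mutually non-isomorphic») is proved by «Statement (2) follows from Lemma D.1» (l. 2270): an isomorphism
`ω(μ', ε', χ') ≃ ω(μ, ε, χ)` restricts at each finite place `v` to `ω(μ'_v, ε'_v, χ'_v) ≃ ω(μ_v, ε_v, χ_v)` (Def. 4.11,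
`ω(μ, ε, χ) := ⊗'_v ω(μ_v, ε_v, χ_v)`), and the LOCAL Lemma D.1 (3) (l. 5233) gives `(μ'_v, ε'_v, χ'_v) = (μ_v, ε_v, χ_v)`, in particular
`μ'_v = μ_v` for all `v`, i.e. `μ' = μ`.  The restriction step for the tree's constructed carriers `rhoAtLine … hs ι a χ` is ✔
`Def411WeilCarriersLocalTypesOfEquiv` (local types `X_v(𝓢, a, χ) := Coinv(ω_v ∘ (u ↦ u·1_n), χ_v) ∘ (k ↦ k ⊗ 1)` on `U(J_V)(F_v)`, from
Lem. D.1 (1) AS PRINTED); the global half `(∀ v, μ_v = μ'_v) ⇒ μ = μ'` is ✔ `CMSplittingCharLocalMuSeparates`.  This file supplies the middle: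
Lemma D.1 (3) AS PRINTED is a statement about [Liu2021, App. D §D.1]'s data `(F, E, V, ε, μ, χ; ω(μ, ε))` for ONE hermitian space `V` and two
choices of Steps 1–3; the tree's existing local datum `localLemD1Data … a 𝓢 …` (`Def411IrreducibleOfLemD1AsPrinted.lean`) sits on the hermitian
matrix `J_V ⊗ J_W a` of the PAIR, which depends on the line `a` — two carriers with different lines live over different standing data.  Since
`W = ⟨a⟩` is a line, `U(J_V ⊗ J_W a)(F_v) = U(J_V)(F_v)` along `k ↦ k ⊗ 1` (✔ `UnitaryGroup.localLineInl`, onto), so the SAME local Weil datum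
is presented over the standing data of `J_V` itself:

* §1 `J_V` is hermitian and non-degenerate (`T_V` symmetric over `F`, `det T_V` a unit); `2 ≤ N`, `3 ≤ N` from `e : Fin N × Fin 1 ≃ Fin n`, `3 ≤ n`;
* §2 `epsLine a v := (a·δ) ⊗ 1 ∈ E_v^{−×}` — the Step-1 REPRESENTATIVE of the class `ε_v` of the line `⟨a⟩` (Liu's `e = a·δ ∈ E^{×−}`, Def. 4.12;
  the tree's `Eps` normalisation `ε_v ↦ ε_v/δ`, `epsOf_algebraMap_mul`: the collection of `a·δ` is `locF a`);
* §3 **`localLemD1DataAtV … a 𝓢 … μ … χ … v : LemD1Data F_v E_v N 𝒮(F_vⁿ)`** — standing data `LemD1OfPlace.standingData` at `J_V`, Step 1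
  `epsLine a v`, Step 2 `μ_v`, Step 3 `χ_v ∘ θ` (`χ_v = localCharOfCenter … (J_W a) χ v`), ⟨CARRIER⟩ `omega := ω_v ∘ (k ↦ k ⊗ 1) ∘ uEquiv` with
  `ω_v = 𝓢.omegaLoc v` (Liu's `ω(ε_v) ∘ ι_{μ_v}` for `V` at `v` — the same object-match duty as the displayed `hD1`);
* §4 `quotEquivLocalType` — the datum's `ω(μ_v, ε_v, χ_v)` (`datum.quot`, on `U(V)(F_v) = S.U`) IS the local type `X_v(𝓢, a, χ)` read along
  `uEquiv : S.U ≃ₜ* U(J_V)(F_v)` (identity on representatives: `augmentation = ker`, `LemD1OfPlace.coinvEquiv`, `ker_comp_of_surjective θ`, and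
  `(k ↦ k ⊗ 1) ∘ (z·1_N) = z·1_n`, ✔ `localLineInl_localCenter`);
* §4 `isIrreducible_localType_of_lemD1AsPrintedAtV` — the local type is irreducible from Lem. D.1 (1) AS PRINTED at THIS datum (`n ≥ 3`);
* §5 **`localIndexedFamilyAtV … v`** — for a collection `i ↦ (a_i, χ_i, 𝓢_i, μ_{i,•})` of global data over one `J_V`, the INDEXED FAMILY
  (`LemD1IndexedFamily`, ✔ `LemD1AsPrintedIndexed.lean`) of these data at `v`; `single i = localLemD1DataAtV … (a_i) (𝓢_i) … (μ_i) … (χ_i) … v` (`rfl`);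
* §6 **`forall_localMu_eq_of_equiv_of_lemD1AsPrintedI`** — THE CROSS-`μ` SEPARATION, local half: for such a collection with splitting families
  `s_i` factoring through `𝓢_i` (`hfac`), `n ≥ 3`, [Lem. D.1 (1)] AS PRINTED at every pair datum (`hD1`, the displayed shape) and [Lem. D.1 (3)]
  AS PRINTED read on `localIndexedFamilyAtV … v` at every `v` (`hD3`), and `ι : G →* U(J_V)(𝔸_f)` onto: a `G`-equivariant linear equivalence
  `ω(s_i, a_i, χ_i) ≃ ω(s_j, a_j, χ_j)` with `ω(s_i, a_i, χ_i) ≠ 0` forces `μ_{i,v} = μ_{j,v}` at EVERY finite place `v`;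
  `forall_localMu_eq_of_equiv_of_lemD1AsPrintedAtV` — the same with Lem. D.1 (1) read on the indexed family itself (`Item1AsPrinted`) instead of the
  pair data, so that ONE displayed family «Lem. D.1 (1) ∧ (3) AS PRINTED at the tree's local data of all triples» suffices.

HC_CM is NOT proved and not mentioned further; «Δ2 BRIDGE CLOSED» is NOT claimed.  Cell pub-hodgecm2 (COR-CM), Δ2 BRIDGE cite leg `hμsep`;
seat prover-pub-hodgecm2-b10-g69-0.

## References
* [Liu2021] Y. Liu, Camb. J. Math. 9 (2021) = arXiv:2102.11518: Def. 4.11 (l. 2083–2097), Def. 4.12 (l. 2102–2108), Thm. 4.18 (2) and its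
  proof (l. 2241, 2270), App. D §D.1 Steps 1∕2∕3 (l. 5213–5224), Lem. D.1 (l. 5226–5237; (1) l. 5229; (3) l. 5233).
* [GelbartRogawski1991] S. Gelbart, J. Rogawski, Invent. Math. 105 (1991), §3.1 p. 454, Prop. 3.1.1 p. 455 L1–3, §3.2 p. 457.
* [Mok2014] C. P. Mok, Mem. AMS 235 (2015), §1 Notation p. 5.  [FlathCorvallis1979] D. Flath, PSPM 33.1, Theorem 3.
-/

set_option autoImplicit false

noncomputable section

open scoped Matrix Kronecker RestrictedProduct NumberField Classical
open NumberField IsDedekindDomain Filter Set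
open Literature.NumberTheory Literature.NumberTheory.Automorphic Literature.NumberTheory.Automorphic.UnitaryGroup
open Literature.NumberTheory.GelbartRogawski1991 Literature.NumberTheory.GelbartRogawski1991.UnitaryDualPair
open Literature.NumberTheory.GelbartRogawski1991.UnitaryDualPair.WeilCoinv
open Literature.NumberTheory.Weil1964 Literature.RepresentationTheory
open Literature.RepresentationTheory.CentralCharacterQuotient (augmentation)

namespace Literature.NumberTheory.Automorphic.Liu2021.Def411WeilCarriers

variable (F E : Type) [Field F] [NumberField F] [Field E] [NumberField E] [Algebra F E]
variable (c : E ≃ₐ[F] E) (N : ℕ) {n : ℕ} (e : Fin N × Fin 1 ≃ Fin n)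
variable (JV : Matrix (Fin N) (Fin N) E) {TV : Matrix (Fin N) (Fin N) F}
variable [Algebra.IsQuadraticExtension F E] {δ : E} (hcδ : c δ = -δ) (hδ : δ ≠ 0) {d : F} (hd : δ * δ = algebraMap F E d)
/- (every further binder explicit per declaration — no section `variable` carrying a hypothesis, per the gate's D-0026 readout) -/

/-! ## §1 `J_V` is hermitian and non-degenerate; the ranks -/

section Form

omit [NumberField F] [NumberField E] [Algebra.IsQuadraticExtension F E] in
/-- `J_V = T_V ⊗ 1` is hermitian: `(c J_V)ᵀ = J_V` (`T_V` symmetric with entries in `F`). [cite: GelbartRogawski1991, §3.1 p. 454] -/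
theorem transpose_map_conj_JV (hV : TV.IsSymm) (hJV : JV = TV.map (algebraMap F E)) : (JV.map c)ᵀ = JV := by
  rw [hJV, Matrix.map_map]
  have h : (⇑c ∘ ⇑(algebraMap F E)) = ⇑(algebraMap F E) := funext fun t => c.commutes t
  rw [h, ← Matrix.transpose_map, hV.eq]

omit [NumberField F] [NumberField E] [Algebra.IsQuadraticExtension F E] in
/-- `det J_V ≠ 0` (`det T_V` a unit). [cite: GelbartRogawski1991, §3.1 p. 454] -/
theorem det_JV_ne_zero (hVd : IsUnit TV.det) (hJV : JV = TV.map (algebraMap F E)) : JV.det ≠ 0 := by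
  rw [hJV]
  exact (UnitaryGroup.isUnit_det_map (algebraMap F E) hVd).ne_zero

/-- `N = n` for `e : Fin N × Fin 1 ≃ Fin n` (plumbing). [folklore] -/
private theorem rank_eq_of_equiv (e : Fin N × Fin 1 ≃ Fin n) : N = n := by
  simpa using Fintype.card_congr e

/-- `2 ≤ N` when `3 ≤ n` (`N = n`; plumbing). [folklore] -/
private theorem two_le_rank (e : Fin N × Fin 1 ≃ Fin n) (hn : 3 ≤ n) : 2 ≤ N := by
  have := rank_eq_of_equiv N e; omega

/-- `3 ≤ N` when `3 ≤ n` (`N = n`; plumbing). [folklore] -/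
private theorem three_le_rank (e : Fin N × Fin 1 ≃ Fin n) (hn : 3 ≤ n) : 3 ≤ N := by
  have := rank_eq_of_equiv N e; omega

end Form

/-! ## §2 Step 1's representative `(a·δ) ⊗ 1` of the class of the line `⟨a⟩` -/

section EpsLine

variable {F c N JV}

omit [NumberField F] [NumberField E] [Algebra.IsQuadraticExtension F E] in
/-- `a·δ ≠ 0` in `E` (`a` a unit of `F`, `δ ≠ 0`; plumbing). [folklore] -/
private theorem algebraMap_mul_delta_ne_zero (hδ : δ ≠ 0) (a : Fˣ) : algebraMap F E (a : F) * δ ≠ 0 :=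
  mul_ne_zero ((map_ne_zero (algebraMap F E)).2 a.ne_zero) hδ

/-- **Step 1's representative of the line `⟨a⟩` at `v`**: `ε_v := (a·δ) ⊗ 1`, a unit of `E_v` — [Liu2021, Def. 4.12]'s `e = a·δ ∈ E^{×−}`
whose collection `(e · Nm E_v^×)_v` is the tree's `locF a` (`epsOf_algebraMap_mul`), read in `E_v = E ⊗_F F_v`.
[cite: Liu2021, Def. 4.12 (l. 2102–2108) and App. D §D.1 Step 1 (l. 5217)] -/
def epsLine (a : Fˣ) (v : HeightOneSpectrum (𝓞 F)) : (LocalRing E v)ˣ :=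
  Units.map (algebraMap E (LocalRing E v)).toMonoidHom (Units.mk0 (algebraMap F E (a : F) * δ) (algebraMap_mul_delta_ne_zero E hδ a))

omit [NumberField F] [Algebra.IsQuadraticExtension F E] in
/-- unfolding: `epsLine a v = (a·δ) ⊗ 1`. [cite: Liu2021, App. D §D.1 Step 1 (l. 5217)] -/
theorem coe_epsLine (a : Fˣ) (v : HeightOneSpectrum (𝓞 F)) :
    ((epsLine E hδ a v : (LocalRing E v)ˣ) : LocalRing E v) = algebraMap E (LocalRing E v) (algebraMap F E (a : F) * δ) := rfl

variable (c N JV)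

/-- `ε_v + ε_vᶜ = 0` (`c (a·δ) = −a·δ`): `epsLine a v ∈ E_v⁻ = S.skew` for the standing data at `v` (any hermitian `J`).
[cite: Liu2021, App. D §D.1 Step 1 (l. 5217)] -/
theorem epsLine_mem_skew (hN : 2 ≤ N) (hJh : (JV.map c)ᵀ = JV) (hJdet : JV.det ≠ 0) (a : Fˣ) (v : HeightOneSpectrum (𝓞 F)) :
    ((epsLine E hδ a v : (LocalRing E v)ˣ) : LocalRing E v) ∈ (LemD1OfPlace.standingData E v c N JV hcδ hδ hN hJh hJdet).skew := by
  rw [Literature.RepresentationTheory.Liu2021.OscillatorStandingData.mem_skew_iff, coe_epsLine,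
    LemD1OfPlace.standingData_conj_apply, conjLocal_algebraMap, map_mul c, AlgEquiv.commutes, hcδ, mul_neg, map_neg, add_neg_cancel]

end EpsLine

/-! ## §2b Irreducibility along an equivalence onto a pulled-back representation (generic bookkeeping) -/

section Generic

variable {k : Type*} [Field k] {G₁ G₂ V₁ V₂ : Type*} [Group G₁] [Group G₂] [AddCommGroup V₁] [Module k V₁] [AddCommGroup V₂] [Module k V₂]

/-- **Irreducibility passes along an equivalence `ρ₁ ≃ ρ₂ ∘ φ` with `φ` onto**: if `ρ₁` (a representation of `G₁`) is equivalent to the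
pull-back of `ρ₂` (a representation of `G₂`) along a surjective `φ : G₁ →* G₂` and `ρ₁` is irreducible, then `ρ₂` is irreducible
(✔ `Representation.isIrreducible_iff_of_equivariant`, the equivariance read off the `Representation.Equiv`). [cite: Bump1997, §4.2 (twisting a representation by a character)] -/
theorem isIrreducible_of_equiv_comp (ρ₁ : Representation k G₁ V₁) (ρ₂ : Representation k G₂ V₂) (φ : G₁ →* G₂)
    (hφ : Function.Surjective φ) (E : ρ₁.Equiv (show Representation k G₁ V₂ from ρ₂.comp φ)) (h : ρ₁.IsIrreducible) : ρ₂.IsIrreducible :=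
  (Representation.isIrreducible_iff_of_equivariant ρ₁ ρ₂ φ hφ E.toLinearEquiv fun g x => by
    rw [Representation.Equiv.toLinearEquiv_apply, Representation.Equiv.toLinearEquiv_apply]
    exact E.toIntertwiningMap.isIntertwining _ _ g x).1 h

end Generic

/-! ## §3 [Liu2021, App. D §D.1]'s data at `v` for `V` itself, on the local type's carrier `ω_v ∘ (k ↦ k ⊗ 1)` -/

section LocalData

/-- **[Liu2021, App. D §D.1]'s data `(F_v, E_v, U(V)(F_v), ε_v = (a·δ) ⊗ 1, μ_v, χ_v; ω_v ∘ (k ↦ k ⊗ 1))` AS PRINTED at the finite place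
`v`, for the hermitian space `V = (E^N, J_V)` ITSELF** (`LemD1Data` of `LemD1AsPrinted.lean`): standing data `LemD1OfPlace.standingData` at `J_V`
(hermitian, `det ≠ 0`, `N ≥ 2`); Step 1's representative `epsLine a v` of the line's class; Step 2's `μ_v` the caller's `μ v`; Step 3's
character the local component `χ_v = localCharOfCenter … (J_W a) χ v` of `χ` read on `E_v¹` through `θ`; ⟨CARRIER⟩ `omega` = the local Weil
representation `ω_v = 𝓢.omegaLoc v` of the pair `U(J_V ⊗ J_W a)(F_v)` pulled back along `k ↦ k ⊗ 1` to `U(J_V)(F_v)` and read on `S.U` along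
`uEquiv` (Liu's `ω(ε_v) ∘ ι_{μ_v}` for `V` at `v`: the object-match duty of the displayed `hD1`, unchanged).  Lemma D.1 for THIS datum is a
hypothesis of the consumer — not claimed. [cite: Liu2021, App. D §D.1 Steps 1∕2∕3 (l. 5213–5224)] [cite: Mok2014, §1 Notation p. 5] -/
def localLemD1DataAtV (hV : TV.IsSymm) (hVd : IsUnit TV.det)
    (hJV : JV = TV.map (algebraMap F E)) (a : Fˣ)
    (𝓢 : LocalSplitting.FinLocalSplittings F E c n hcδ hδ hd (gram F e TV (TW F a)) (isSymm_gram F e hV (isSymm_TW F a))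
      (reindex_kronecker_eq_gram_map F E e hJV (JW_eq F E a)))
    (hn : 3 ≤ n) (μ : ∀ v : HeightOneSpectrum (𝓞 F), (LocalRing E v)ˣ →* ℂˣ) (hμn : ∀ v x, ‖((μ v x : ℂˣ) : ℂ)‖ = 1)
    (hμc : ∀ v, Continuous fun x => ((μ v x : ℂˣ) : ℂ))
    (hμF : ∀ (v : HeightOneSpectrum (𝓞 F)) (t : (v.adicCompletion F)ˣ),
      μ v (Units.map (algebraMap (v.adicCompletion F) (LocalRing E v)).toMonoidHom t) = 1 ↔
        ∃ x : (LocalRing E v)ˣ, (x : LocalRing E v) * conjLocal E c v x = algebraMap (v.adicCompletion F) (LocalRing E v) t)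
    (χ : Chi F E c) (v : HeightOneSpectrum (𝓞 F)) :
    LemD1Data (v.adicCompletion F) (LocalRing E v) N (SchwartzBruhat (Fin n → v.adicCompletion F)) where
  isNonarchimedeanLocalField := inferInstance
  isModuleTopology := LemD1OfPlace.isModuleTopology_localRing E v
  S := LemD1OfPlace.standingData E v c N JV hcδ hδ (two_le_rank N e hn) (transpose_map_conj_JV F E c N JV hV hJV)
    (det_JV_ne_zero F E N JV hVd hJV)
  eps := epsLine E hδ a v
  eps_mem_skew := epsLine_mem_skew E c N JV hcδ hδ (two_le_rank N e hn) (transpose_map_conj_JV F E c N JV hV hJV)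
    (det_JV_ne_zero F E N JV hVd hJV) a v
  mu := μ v
  norm_mu := hμn v
  continuous_mu := hμc v
  mu_algebraMap_eq_one_iff := hμF v
  chi := (localCharOfCenter F E c (JW F E a) (JW_apply_ne_zero F E a) χ.1 v).comp
    (LemD1OfPlace.theta E v c N JV hcδ hδ (two_le_rank N e hn) (transpose_map_conj_JV F E c N JV hV hJV)
      (det_JV_ne_zero F E N JV hVd hJV) (JW F E a))
  norm_chi _ := norm_localCharOfCenter F E c (JW F E a) (JW_apply_ne_zero F E a)
    (norm_chi_eq_one F E c (Algebra.IsQuadraticExtension.finrank_eq_two F E) (UnitaryGroup.algEquiv_ne_one_of_apply_eq_neg F E c hcδ hδ) χ)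
    v _
  continuous_chi := (continuous_coe_localCharOfCenter F E c (JW F E a) (JW_apply_ne_zero F E a) χ.2.1 v).comp
    (LemD1OfPlace.continuous_theta E v c N JV hcδ hδ (two_le_rank N e hn) (transpose_map_conj_JV F E c N JV hV hJV)
      (det_JV_ne_zero F E N JV hVd hJV) (JW F E a))
  omega := (show Representation ℂ (UnitaryGroup.localPi E c N JV v) (SchwartzBruhat (Fin n → v.adicCompletion F)) from
      (𝓢.omegaLoc v).comp (UnitaryGroup.localLineInl E c N e JV (JW F E a) v)).comp
    (LemD1OfPlace.uEquiv E v c N JV hcδ hδ (two_le_rank N e hn) (transpose_map_conj_JV F E c N JV hV hJV)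
      (det_JV_ne_zero F E N JV hVd hJV)).toMulEquiv.toMonoidHom

/-- unfolding: the Step-2 character of the datum is `μ v`. [cite: Liu2021, App. D §D.1 Step 2 (l. 5219)] -/
@[simp] theorem localLemD1DataAtV_mu (hV : TV.IsSymm) (hVd : IsUnit TV.det)
    (hJV : JV = TV.map (algebraMap F E)) (a : Fˣ)
    (𝓢 : LocalSplitting.FinLocalSplittings F E c n hcδ hδ hd (gram F e TV (TW F a)) (isSymm_gram F e hV (isSymm_TW F a))
      (reindex_kronecker_eq_gram_map F E e hJV (JW_eq F E a)))
    (hn : 3 ≤ n) (μ : ∀ v : HeightOneSpectrum (𝓞 F), (LocalRing E v)ˣ →* ℂˣ) (hμn : ∀ v x, ‖((μ v x : ℂˣ) : ℂ)‖ = 1)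
    (hμc : ∀ v, Continuous fun x => ((μ v x : ℂˣ) : ℂ))
    (hμF : ∀ (v : HeightOneSpectrum (𝓞 F)) (t : (v.adicCompletion F)ˣ),
      μ v (Units.map (algebraMap (v.adicCompletion F) (LocalRing E v)).toMonoidHom t) = 1 ↔
        ∃ x : (LocalRing E v)ˣ, (x : LocalRing E v) * conjLocal E c v x = algebraMap (v.adicCompletion F) (LocalRing E v) t)
    (χ : Chi F E c) (v : HeightOneSpectrum (𝓞 F)) :
    (localLemD1DataAtV F E c N e JV hcδ hδ hd hV hVd hJV a 𝓢 hn μ hμn hμc hμF χ v).mu = μ v := rfl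

/-- unfolding: the Step-1 representative of the datum is `(a·δ) ⊗ 1`. [cite: Liu2021, App. D §D.1 Step 1 (l. 5217)] -/
@[simp] theorem localLemD1DataAtV_eps (hV : TV.IsSymm) (hVd : IsUnit TV.det)
    (hJV : JV = TV.map (algebraMap F E)) (a : Fˣ)
    (𝓢 : LocalSplitting.FinLocalSplittings F E c n hcδ hδ hd (gram F e TV (TW F a)) (isSymm_gram F e hV (isSymm_TW F a))
      (reindex_kronecker_eq_gram_map F E e hJV (JW_eq F E a)))
    (hn : 3 ≤ n) (μ : ∀ v : HeightOneSpectrum (𝓞 F), (LocalRing E v)ˣ →* ℂˣ) (hμn : ∀ v x, ‖((μ v x : ℂˣ) : ℂ)‖ = 1)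
    (hμc : ∀ v, Continuous fun x => ((μ v x : ℂˣ) : ℂ))
    (hμF : ∀ (v : HeightOneSpectrum (𝓞 F)) (t : (v.adicCompletion F)ˣ),
      μ v (Units.map (algebraMap (v.adicCompletion F) (LocalRing E v)).toMonoidHom t) = 1 ↔
        ∃ x : (LocalRing E v)ˣ, (x : LocalRing E v) * conjLocal E c v x = algebraMap (v.adicCompletion F) (LocalRing E v) t)
    (χ : Chi F E c) (v : HeightOneSpectrum (𝓞 F)) :
    (localLemD1DataAtV F E c N e JV hcδ hδ hd hV hVd hJV a 𝓢 hn μ hμn hμc hμF χ v).eps = epsLine E hδ a v := rfl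

/-! ## §4 The datum's `ω(μ_v, ε_v, χ_v)` IS the local type `X_v(𝓢, a, χ)` read along `uEquiv` -/

/-- the centre of `U(J_V)(F_v)` followed by `k ↦ k ⊗ 1` is the centre of `U(J_V ⊗ J_W a)(F_v)`, on the carrier `ω_v`:
`(ω_v ∘ (k ↦ k ⊗ 1)) ∘ (z·1_N) = ω_v ∘ (z·1_n)` (✔ `localLineInl_localCenter`). [cite: Mok2014, §1 Notation p. 5] -/
theorem omegaLoc_comp_localLineInl_comp_localCenter (hV : TV.IsSymm) (hJV : JV = TV.map (algebraMap F E)) (a : Fˣ)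
    (𝓢 : LocalSplitting.FinLocalSplittings F E c n hcδ hδ hd (gram F e TV (TW F a)) (isSymm_gram F e hV (isSymm_TW F a))
      (reindex_kronecker_eq_gram_map F E e hJV (JW_eq F E a))) (v : HeightOneSpectrum (𝓞 F)) :
    (show Representation ℂ (UnitaryGroup.localPi E c 1 (JW F E a) v) (SchwartzBruhat (Fin n → v.adicCompletion F)) from
        ((show Representation ℂ (UnitaryGroup.localPi E c N JV v) _ from
          (𝓢.omegaLoc v).comp (UnitaryGroup.localLineInl E c N e JV (JW F E a) v)).comp
          (localCenter E c N JV (JW F E a) (JW_apply_ne_zero F E a) v))) =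
      (show Representation ℂ (UnitaryGroup.localPi E c 1 (JW F E a) v) _ from
        (𝓢.omegaLoc v).comp (localCenter E c n (Matrix.reindex e e (JV ⊗ₖ JW F E a)) (JW F E a) (JW_apply_ne_zero F E a) v)) :=
  MonoidHom.ext fun z => congrArg (𝓢.omegaLoc v) (UnitaryGroup.localLineInl_localCenter E c N e JV (JW F E a) (JW F E a)
    (JW_apply_ne_zero F E a) v z)

/-- the two relation submodules of `𝒮(F_vⁿ)` coincide: `ker ((ω_v ∘ (k ↦ k ⊗ 1)) ∘ (z·1_N)) χ_v = ker (ω_v ∘ (z·1_n)) χ_v`.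
[cite: Liu2021, App. D §D.1 Step 3 (l. 5221)] -/
theorem ker_comp_localLineInl_eq (hV : TV.IsSymm) (hJV : JV = TV.map (algebraMap F E)) (a : Fˣ)
    (𝓢 : LocalSplitting.FinLocalSplittings F E c n hcδ hδ hd (gram F e TV (TW F a)) (isSymm_gram F e hV (isSymm_TW F a))
      (reindex_kronecker_eq_gram_map F E e hJV (JW_eq F E a))) (χ : Chi F E c) (v : HeightOneSpectrum (𝓞 F)) :
    TwistedCoinv.ker (show Representation ℂ (UnitaryGroup.localPi E c 1 (JW F E a) v) (SchwartzBruhat (Fin n → v.adicCompletion F)) from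
        ((show Representation ℂ (UnitaryGroup.localPi E c N JV v) _ from
          (𝓢.omegaLoc v).comp (UnitaryGroup.localLineInl E c N e JV (JW F E a) v)).comp
          (localCenter E c N JV (JW F E a) (JW_apply_ne_zero F E a) v)))
        (localCharOfCenter F E c (JW F E a) (JW_apply_ne_zero F E a) χ.1 v) =
      TwistedCoinv.ker (show Representation ℂ (UnitaryGroup.localPi E c 1 (JW F E a) v) _ from
        (𝓢.omegaLoc v).comp (localCenter E c n (Matrix.reindex e e (JV ⊗ₖ JW F E a)) (JW F E a) (JW_apply_ne_zero F E a) v))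
        (localCharOfCenter F E c (JW F E a) (JW_apply_ne_zero F E a) χ.1 v) := by
  rw [omegaLoc_comp_localLineInl_comp_localCenter F E c N e JV hcδ hδ hd hV hJV a 𝓢 v]

/-- **The datum's `ω(μ_v, ε_v, χ_v)` IS the tree's local type `X_v(𝓢, a, χ) = Coinv(ω_v ∘ (u ↦ u·1_n), χ_v) ∘ (k ↦ k ⊗ 1)` read on
`U(V)(F_v) = S.U` along `uEquiv`** (equivariant identification, data; identity on representatives): `quotRep` on `𝒮 ⧸ augmentation` ≃
`Coinv (omega ∘ scalar) chi` (`augmentation = ker`) ≃ `Coinv ((ω_v ∘ (k ↦ k ⊗ 1)) ∘ (z·1_N) ∘ θ, χ_v ∘ θ)` (`LemD1OfPlace.coinvEquiv`, change of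
acting pair) ≃ `Coinv ((ω_v ∘ (k ↦ k ⊗ 1)) ∘ (z·1_N), χ_v)` (`θ` onto) ≃ `Coinv (ω_v ∘ (z·1_n), χ_v)` (same relation submodule,
`ker_comp_localLineInl_eq`).  The transport a supplier of the LOCAL comparison needs to pass between the as-printed currency of `LemD1_3AsPrintedI`
(`quot`) and the local-type currency of ✔ `Def411WeilCarriersLocalTypesOfEquiv`. [cite: Liu2021, App. D §D.1 Step 3 (l. 5221)] [cite: Mok2014, §1 Notation p. 5] -/
def quotEquivLocalType (hV : TV.IsSymm) (hVd : IsUnit TV.det)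
    (hJV : JV = TV.map (algebraMap F E)) (a : Fˣ)
    (𝓢 : LocalSplitting.FinLocalSplittings F E c n hcδ hδ hd (gram F e TV (TW F a)) (isSymm_gram F e hV (isSymm_TW F a))
      (reindex_kronecker_eq_gram_map F E e hJV (JW_eq F E a)))
    (hn : 3 ≤ n) (μ : ∀ v : HeightOneSpectrum (𝓞 F), (LocalRing E v)ˣ →* ℂˣ) (hμn : ∀ v x, ‖((μ v x : ℂˣ) : ℂ)‖ = 1)
    (hμc : ∀ v, Continuous fun x => ((μ v x : ℂˣ) : ℂ))
    (hμF : ∀ (v : HeightOneSpectrum (𝓞 F)) (t : (v.adicCompletion F)ˣ),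
      μ v (Units.map (algebraMap (v.adicCompletion F) (LocalRing E v)).toMonoidHom t) = 1 ↔
        ∃ x : (LocalRing E v)ˣ, (x : LocalRing E v) * conjLocal E c v x = algebraMap (v.adicCompletion F) (LocalRing E v) t)
    (χ : Chi F E c) (v : HeightOneSpectrum (𝓞 F)) :
    ((localLemD1DataAtV F E c N e JV hcδ hδ hd hV hVd hJV a 𝓢 hn μ hμn hμc hμF χ v).datum.quot).Equiv
      ((show Representation ℂ (UnitaryGroup.localPi E c N JV v) _ from
        (TwistedCoinv.rep (localCharOfCenter F E c (JW F E a) (JW_apply_ne_zero F E a) χ.1 v) (𝓢.omegaLoc v)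
          (commute_omegaLoc_localCenter F E c N e JV (JW F E a) hcδ hδ hd hV (isSymm_TW F a) hJV (JW_eq F E a)
            (JW_apply_ne_zero F E a) 𝓢 v)).comp (UnitaryGroup.localLineInl E c N e JV (JW F E a) v)).comp
        (LemD1OfPlace.uEquiv E v c N JV hcδ hδ (two_le_rank N e hn) (transpose_map_conj_JV F E c N JV hV hJV)
          (det_JV_ne_zero F E N JV hVd hJV)).toMulEquiv.toMonoidHom) :=
  Representation.Equiv.mk
    ((Submodule.quotEquivOfEq _ _ (TwistedCoinv.augmentation_eq_ker
        (localLemD1DataAtV F E c N e JV hcδ hδ hd hV hVd hJV a 𝓢 hn μ hμn hμc hμF χ v).omega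
        (LemD1OfPlace.standingData E v c N JV hcδ hδ (two_le_rank N e hn) (transpose_map_conj_JV F E c N JV hV hJV)
          (det_JV_ne_zero F E N JV hVd hJV)).scalar
        (localLemD1DataAtV F E c N e JV hcδ hδ hd hV hVd hJV a 𝓢 hn μ hμn hμc hμF χ v).chi)).trans
      ((LemD1OfPlace.coinvEquiv E v c N JV hcδ hδ (two_le_rank N e hn) (transpose_map_conj_JV F E c N JV hV hJV)
          (det_JV_ne_zero F E N JV hVd hJV) (JW F E a)
          (show Representation ℂ (UnitaryGroup.localPi E c N JV v) (SchwartzBruhat (Fin n → v.adicCompletion F)) from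
            (𝓢.omegaLoc v).comp (UnitaryGroup.localLineInl E c N e JV (JW F E a) v))
          (μ v) (hμn v) (hμc v) (hμF v) (localCharOfCenter F E c (JW F E a) (JW_apply_ne_zero F E a) χ.1 v)
          (norm_localCharOfCenter F E c (JW F E a) (JW_apply_ne_zero F E a)
            (norm_chi_eq_one F E c (Algebra.IsQuadraticExtension.finrank_eq_two F E)
              (UnitaryGroup.algEquiv_ne_one_of_apply_eq_neg F E c hcδ hδ) χ) v)
          (continuous_coe_localCharOfCenter F E c (JW F E a) (JW_apply_ne_zero F E a) χ.2.1 v) (JW_apply_ne_zero F E a)).trans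
        ((Submodule.quotEquivOfEq _ _ (TwistedCoinv.ker_comp_of_surjective
            (show Representation ℂ (UnitaryGroup.localPi E c 1 (JW F E a) v) (SchwartzBruhat (Fin n → v.adicCompletion F)) from
              ((show Representation ℂ (UnitaryGroup.localPi E c N JV v) _ from
                (𝓢.omegaLoc v).comp (UnitaryGroup.localLineInl E c N e JV (JW F E a) v)).comp
                (localCenter E c N JV (JW F E a) (JW_apply_ne_zero F E a) v)))
            (localCharOfCenter F E c (JW F E a) (JW_apply_ne_zero F E a) χ.1 v)
            (LemD1OfPlace.theta E v c N JV hcδ hδ (two_le_rank N e hn) (transpose_map_conj_JV F E c N JV hV hJV)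
              (det_JV_ne_zero F E N JV hVd hJV) (JW F E a))
            (LemD1OfPlace.theta_surjective E v c N JV hcδ hδ (two_le_rank N e hn) (transpose_map_conj_JV F E c N JV hV hJV)
              (det_JV_ne_zero F E N JV hVd hJV) (JW F E a) (JW_apply_ne_zero F E a)))).trans
          (Submodule.quotEquivOfEq _ _ (ker_comp_localLineInl_eq F E c N e JV hcδ hδ hd hV hJV a 𝓢 χ v)))))
    (fun _ => LinearMap.ext fun x => Submodule.Quotient.induction_on _ x fun _ => rfl)

/-- **The local type `X_v(𝓢, a, χ)` is IRREDUCIBLE from [Liu2021, App. D Lem. D.1, first sentence + (1)] AS PRINTED at the datum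
`localLemD1DataAtV … v` for `V` itself** (`n ≥ 3`): the datum's `ω(μ_v, ε_v, χ_v)` is non-zero and irreducible
(`LemD1_1AsPrinted.isIrreducible_of_three_le`), transported along `quotEquivLocalType` and the onto map `uEquiv`.
[cite: Liu2021, App. D Lem. D.1 (l. 5227; (1) l. 5229)] -/
theorem isIrreducible_localType_of_lemD1AsPrintedAtV (hV : TV.IsSymm) (hVd : IsUnit TV.det)
    (hJV : JV = TV.map (algebraMap F E)) (a : Fˣ)
    (𝓢 : LocalSplitting.FinLocalSplittings F E c n hcδ hδ hd (gram F e TV (TW F a)) (isSymm_gram F e hV (isSymm_TW F a))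
      (reindex_kronecker_eq_gram_map F E e hJV (JW_eq F E a)))
    (hn : 3 ≤ n) (μ : ∀ v : HeightOneSpectrum (𝓞 F), (LocalRing E v)ˣ →* ℂˣ) (hμn : ∀ v x, ‖((μ v x : ℂˣ) : ℂ)‖ = 1)
    (hμc : ∀ v, Continuous fun x => ((μ v x : ℂˣ) : ℂ))
    (hμF : ∀ (v : HeightOneSpectrum (𝓞 F)) (t : (v.adicCompletion F)ˣ),
      μ v (Units.map (algebraMap (v.adicCompletion F) (LocalRing E v)).toMonoidHom t) = 1 ↔
        ∃ x : (LocalRing E v)ˣ, (x : LocalRing E v) * conjLocal E c v x = algebraMap (v.adicCompletion F) (LocalRing E v) t)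
    (χ : Chi F E c) (v : HeightOneSpectrum (𝓞 F))
    (hD1 : LemD1_1AsPrinted (localLemD1DataAtV F E c N e JV hcδ hδ hd hV hVd hJV a 𝓢 hn μ hμn hμc hμF χ v)) :
    (show Representation ℂ (UnitaryGroup.localPi E c N JV v) _ from
      (TwistedCoinv.rep (localCharOfCenter F E c (JW F E a) (JW_apply_ne_zero F E a) χ.1 v) (𝓢.omegaLoc v)
        (commute_omegaLoc_localCenter F E c N e JV (JW F E a) hcδ hδ hd hV (isSymm_TW F a) hJV (JW_eq F E a)
          (JW_apply_ne_zero F E a) 𝓢 v)).comp (UnitaryGroup.localLineInl E c N e JV (JW F E a) v)).IsIrreducible := by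
  -- Lem. D.1 (1) AS PRINTED on the datum's own quotient (non-zero for `n ≥ 3`, hence irreducible), transported along `quotEquivLocalType`
  -- (equivariant over the onto map `uEquiv : S.U ≃* U(J_V)(F_v)`)
  exact isIrreducible_of_equiv_comp _ _ _
    (LemD1OfPlace.uEquiv E v c N JV hcδ hδ (two_le_rank N e hn) (transpose_map_conj_JV F E c N JV hV hJV)
      (det_JV_ne_zero F E N JV hVd hJV)).surjective
    (quotEquivLocalType F E c N e JV hcδ hδ hd hV hVd hJV a 𝓢 hn μ hμn hμc hμF χ v)
    (hD1.isIrreducible_of_three_le (three_le_rank N e hn))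

end LocalData

/-! ## §5 The INDEXED FAMILY of these data at `v`, for a collection of global data over one `J_V` -/

section Indexed

/-- **The INDEXED FAMILY of [Liu2021, App. D §D.1]'s data at `v` for a collection `i ↦ (a_i, χ_i, 𝓢_i, μ_{i,•})` of global data over one
hermitian space `J_V`** (`LemD1IndexedFamily`, ✔ `LemD1AsPrintedIndexed.lean`): one standing data `U(J_V)(F_v)`; member `i` = Step 2
`μ_{i,v}` (`LemD1OfPlace.muOf`), Step 1 `(a_i·δ) ⊗ 1`, Step 3 `χ_{i,v} ∘ θ`, ⟨CARRIER⟩ `(𝓢_i).omegaLoc v ∘ (k ↦ k ⊗ 1) ∘ uEquiv`; `single i` IS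
`localLemD1DataAtV … (a_i) (𝓢_i) … (μ_i) … (χ_i) … v` (`rfl`).  The consumer's [Lem. D.1 (3)] AS PRINTED cite at `v` is
`LemD1_3AsPrintedI (localIndexedFamilyAtV … v)` — Liu's (3) read on the triples `(μ_{i,v}, ε_{i,v}, χ_{i,v})`, `i ∈ ι`.
[cite: Liu2021, App. D §D.1 Steps 1∕2∕3 (l. 5213–5224) and Lemma D.1 (3) (l. 5233)] -/
def localIndexedFamilyAtV (hV : TV.IsSymm) (hVd : IsUnit TV.det)
    (hJV : JV = TV.map (algebraMap F E))
    (hn : 3 ≤ n) {ι : Type} (aOf : ι → Fˣ) (χOf : ι → Chi F E c)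
    (𝓢Of : ∀ i, LocalSplitting.FinLocalSplittings F E c n hcδ hδ hd (gram F e TV (TW F (aOf i))) (isSymm_gram F e hV (isSymm_TW F (aOf i)))
      (reindex_kronecker_eq_gram_map F E e hJV (JW_eq F E (aOf i))))
    (μOf : ι → ∀ v : HeightOneSpectrum (𝓞 F), (LocalRing E v)ˣ →* ℂˣ) (hμn : ∀ i v x, ‖((μOf i v x : ℂˣ) : ℂ)‖ = 1)
    (hμc : ∀ i v, Continuous fun x => ((μOf i v x : ℂˣ) : ℂ))
    (hμF : ∀ (i : ι) (v : HeightOneSpectrum (𝓞 F)) (t : (v.adicCompletion F)ˣ),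
      μOf i v (Units.map (algebraMap (v.adicCompletion F) (LocalRing E v)).toMonoidHom t) = 1 ↔
        ∃ x : (LocalRing E v)ˣ, (x : LocalRing E v) * conjLocal E c v x = algebraMap (v.adicCompletion F) (LocalRing E v) t)
    (v : HeightOneSpectrum (𝓞 F)) : LemD1IndexedFamily (v.adicCompletion F) (LocalRing E v) N ι where
  isNonarchimedeanLocalField := inferInstance
  isModuleTopology := LemD1OfPlace.isModuleTopology_localRing E v
  S := LemD1OfPlace.standingData E v c N JV hcδ hδ (two_le_rank N e hn) (transpose_map_conj_JV F E c N JV hV hJV)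
    (det_JV_ne_zero F E N JV hVd hJV)
  mu i := LemD1OfPlace.muOf E v c N JV hcδ hδ (two_le_rank N e hn) (transpose_map_conj_JV F E c N JV hV hJV)
    (det_JV_ne_zero F E N JV hVd hJV) (μOf i v) (hμn i v) (hμc i v) (hμF i v)
  eps i := ⟨epsLine E hδ (aOf i) v, epsLine_mem_skew E c N JV hcδ hδ (two_le_rank N e hn) (transpose_map_conj_JV F E c N JV hV hJV)
    (det_JV_ne_zero F E N JV hVd hJV) (aOf i) v⟩
  chi i := LemD1OfPlace.chiOf E v c N JV hcδ hδ (two_le_rank N e hn) (transpose_map_conj_JV F E c N JV hV hJV)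
    (det_JV_ne_zero F E N JV hVd hJV) (JW F E (aOf i)) (localCharOfCenter F E c (JW F E (aOf i)) (JW_apply_ne_zero F E (aOf i)) (χOf i).1 v)
    (norm_localCharOfCenter F E c (JW F E (aOf i)) (JW_apply_ne_zero F E (aOf i))
      (norm_chi_eq_one F E c (Algebra.IsQuadraticExtension.finrank_eq_two F E)
        (UnitaryGroup.algEquiv_ne_one_of_apply_eq_neg F E c hcδ hδ) (χOf i)) v)
    (continuous_coe_localCharOfCenter F E c (JW F E (aOf i)) (JW_apply_ne_zero F E (aOf i)) (χOf i).2.1 v)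
  V _ := SchwartzBruhat (Fin n → v.adicCompletion F)
  omega i := (show Representation ℂ (UnitaryGroup.localPi E c N JV v) (SchwartzBruhat (Fin n → v.adicCompletion F)) from
      ((𝓢Of i).omegaLoc v).comp (UnitaryGroup.localLineInl E c N e JV (JW F E (aOf i)) v)).comp
    (LemD1OfPlace.uEquiv E v c N JV hcδ hδ (two_le_rank N e hn) (transpose_map_conj_JV F E c N JV hV hJV)
      (det_JV_ne_zero F E N JV hVd hJV)).toMulEquiv.toMonoidHom

/-- **IDENTITY OF RECORDS**: member `i` of the indexed family IS the datum `localLemD1DataAtV` of the global data `i` (`rfl`).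
[cite: Liu2021, App. D §D.1 Steps 1∕2∕3 (l. 5213–5224)] -/
theorem single_localIndexedFamilyAtV (hV : TV.IsSymm) (hVd : IsUnit TV.det)
    (hJV : JV = TV.map (algebraMap F E))
    (hn : 3 ≤ n) {ι : Type} (aOf : ι → Fˣ) (χOf : ι → Chi F E c)
    (𝓢Of : ∀ i, LocalSplitting.FinLocalSplittings F E c n hcδ hδ hd (gram F e TV (TW F (aOf i))) (isSymm_gram F e hV (isSymm_TW F (aOf i)))
      (reindex_kronecker_eq_gram_map F E e hJV (JW_eq F E (aOf i))))
    (μOf : ι → ∀ v : HeightOneSpectrum (𝓞 F), (LocalRing E v)ˣ →* ℂˣ) (hμn : ∀ i v x, ‖((μOf i v x : ℂˣ) : ℂ)‖ = 1)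
    (hμc : ∀ i v, Continuous fun x => ((μOf i v x : ℂˣ) : ℂ))
    (hμF : ∀ (i : ι) (v : HeightOneSpectrum (𝓞 F)) (t : (v.adicCompletion F)ˣ),
      μOf i v (Units.map (algebraMap (v.adicCompletion F) (LocalRing E v)).toMonoidHom t) = 1 ↔
        ∃ x : (LocalRing E v)ˣ, (x : LocalRing E v) * conjLocal E c v x = algebraMap (v.adicCompletion F) (LocalRing E v) t)
    (v : HeightOneSpectrum (𝓞 F)) (i : ι) :
    (localIndexedFamilyAtV F E c N e JV hcδ hδ hd hV hVd hJV hn aOf χOf 𝓢Of μOf hμn hμc hμF v).single i =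
      localLemD1DataAtV F E c N e JV hcδ hδ hd hV hVd hJV (aOf i) (𝓢Of i) hn (μOf i) (hμn i) (hμc i) (hμF i) (χOf i) v := rfl

/-- unfolding: the Step-2 character of member `i` is `μOf i v`. [cite: Liu2021, App. D §D.1 Step 2 (l. 5219)] -/
@[simp] theorem localIndexedFamilyAtV_mu_val (hV : TV.IsSymm) (hVd : IsUnit TV.det)
    (hJV : JV = TV.map (algebraMap F E))
    (hn : 3 ≤ n) {ι : Type} (aOf : ι → Fˣ) (χOf : ι → Chi F E c)
    (𝓢Of : ∀ i, LocalSplitting.FinLocalSplittings F E c n hcδ hδ hd (gram F e TV (TW F (aOf i))) (isSymm_gram F e hV (isSymm_TW F (aOf i)))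
      (reindex_kronecker_eq_gram_map F E e hJV (JW_eq F E (aOf i))))
    (μOf : ι → ∀ v : HeightOneSpectrum (𝓞 F), (LocalRing E v)ˣ →* ℂˣ) (hμn : ∀ i v x, ‖((μOf i v x : ℂˣ) : ℂ)‖ = 1)
    (hμc : ∀ i v, Continuous fun x => ((μOf i v x : ℂˣ) : ℂ))
    (hμF : ∀ (i : ι) (v : HeightOneSpectrum (𝓞 F)) (t : (v.adicCompletion F)ˣ),
      μOf i v (Units.map (algebraMap (v.adicCompletion F) (LocalRing E v)).toMonoidHom t) = 1 ↔
        ∃ x : (LocalRing E v)ˣ, (x : LocalRing E v) * conjLocal E c v x = algebraMap (v.adicCompletion F) (LocalRing E v) t)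
    (v : HeightOneSpectrum (𝓞 F)) (i : ι) :
    ((localIndexedFamilyAtV F E c N e JV hcδ hδ hd hV hVd hJV hn aOf χOf 𝓢Of μOf hμn hμc hμF v).mu i).1 = μOf i v := rfl

/-! ## §6 THE CROSS-`μ` SEPARATION (local half) from [Lem. D.1 (1), (3)] AS PRINTED -/

/-- **Lemma D.1 (3) AS PRINTED, read on the indexed family at `v`, in LOCAL-TYPE currency**: an equivalence of the local types
`X_v(𝓢_i, a_i, χ_i) ≃ X_v(𝓢_j, a_j, χ_j)` of `U(J_V)(F_v)` forces `μ_{i,v} = μ_{j,v}` (through `quotEquivLocalType` and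
`LemD1_3AsPrintedI.mu_eq_of_nonempty_equiv`). [cite: Liu2021, App. D Lemma D.1 (3) (l. 5233)] -/
theorem localMu_eq_of_nonempty_equiv_localTypes (hV : TV.IsSymm) (hVd : IsUnit TV.det)
    (hJV : JV = TV.map (algebraMap F E))
    (hn : 3 ≤ n) {ι : Type} (aOf : ι → Fˣ) (χOf : ι → Chi F E c)
    (𝓢Of : ∀ i, LocalSplitting.FinLocalSplittings F E c n hcδ hδ hd (gram F e TV (TW F (aOf i))) (isSymm_gram F e hV (isSymm_TW F (aOf i)))
      (reindex_kronecker_eq_gram_map F E e hJV (JW_eq F E (aOf i))))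
    (μOf : ι → ∀ v : HeightOneSpectrum (𝓞 F), (LocalRing E v)ˣ →* ℂˣ) (hμn : ∀ i v x, ‖((μOf i v x : ℂˣ) : ℂ)‖ = 1)
    (hμc : ∀ i v, Continuous fun x => ((μOf i v x : ℂˣ) : ℂ))
    (hμF : ∀ (i : ι) (v : HeightOneSpectrum (𝓞 F)) (t : (v.adicCompletion F)ˣ),
      μOf i v (Units.map (algebraMap (v.adicCompletion F) (LocalRing E v)).toMonoidHom t) = 1 ↔
        ∃ x : (LocalRing E v)ˣ, (x : LocalRing E v) * conjLocal E c v x = algebraMap (v.adicCompletion F) (LocalRing E v) t)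
    (hD3 : ∀ v, LemD1_3AsPrintedI (localIndexedFamilyAtV F E c N e JV hcδ hδ hd hV hVd hJV hn aOf χOf 𝓢Of μOf hμn hμc hμF v)) (v : HeightOneSpectrum (𝓞 F)) (i j : ι)
    (h : Nonempty ((show Representation ℂ (UnitaryGroup.localPi E c N JV v) _ from
        (TwistedCoinv.rep (localCharOfCenter F E c (JW F E (aOf i)) (JW_apply_ne_zero F E (aOf i)) (χOf i).1 v) ((𝓢Of i).omegaLoc v)
          (commute_omegaLoc_localCenter F E c N e JV (JW F E (aOf i)) hcδ hδ hd hV (isSymm_TW F (aOf i)) hJV (JW_eq F E (aOf i))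
            (JW_apply_ne_zero F E (aOf i)) (𝓢Of i) v)).comp (UnitaryGroup.localLineInl E c N e JV (JW F E (aOf i)) v)).Equiv
      (show Representation ℂ (UnitaryGroup.localPi E c N JV v) _ from
        (TwistedCoinv.rep (localCharOfCenter F E c (JW F E (aOf j)) (JW_apply_ne_zero F E (aOf j)) (χOf j).1 v) ((𝓢Of j).omegaLoc v)
          (commute_omegaLoc_localCenter F E c N e JV (JW F E (aOf j)) hcδ hδ hd hV (isSymm_TW F (aOf j)) hJV (JW_eq F E (aOf j))
            (JW_apply_ne_zero F E (aOf j)) (𝓢Of j) v)).comp (UnitaryGroup.localLineInl E c N e JV (JW F E (aOf j)) v)))) :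
    μOf i v = μOf j v := by
  obtain ⟨eqv⟩ := h
  -- `quot i ≃ X_i ∘ uEquiv ≃ X_j ∘ uEquiv ≃ quot j` (the middle step: `eqv` read on `S.U` along `uEquiv`)
  have key := (hD3 v).mu_eq_of_nonempty_equiv (three_le_rank N e hn) (i := i) (j := j)
    ⟨((quotEquivLocalType F E c N e JV hcδ hδ hd hV hVd hJV (aOf i) (𝓢Of i) hn (μOf i) (hμn i) (hμc i) (hμF i) (χOf i) v).trans
      (Representation.Equiv.mk eqv.toLinearEquiv fun u => by
        rw [Representation.Equiv.toLinearEquiv_toLinearMap]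
        exact eqv.isIntertwining' _)).trans
      (quotEquivLocalType F E c N e JV hcδ hδ hd hV hVd hJV (aOf j) (𝓢Of j) hn (μOf j) (hμn j) (hμc j) (hμF j) (χOf j) v).symm⟩
  exact congrArg Subtype.val key

/-- **THE CROSS-`μ` SEPARATION `hμsep`, local half, from [Liu2021, App. D Lem. D.1 (1), (3)] AS PRINTED** («Statement (2) follows from Lemma
D.1», l. 2270): for a collection `i ↦ (s_i, a_i, χ_i, 𝓢_i, μ_{i,•})` of the tree's [Def. 4.11] data over one `J_V` with `s_i(a_i)` factoring
through `𝓢_i` (`hfac`), `n ≥ 3`, Lem. D.1 (1) AS PRINTED at every pair datum (`hD1`, the displayed shape), Lem. D.1 (3) AS PRINTED read on the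
indexed family `localIndexedFamilyAtV … v` at every `v` (`hD3`), and `ι : G →* U(J_V)(𝔸_f)` onto: if `ω(s_i, a_i, χ_i) ≠ 0` and there is a
`G`-equivariant `ℂ`-linear equivalence `ω(s_i, a_i, χ_i) ≃ ω(s_j, a_j, χ_j)`, then `μ_{i,v} = μ_{j,v}` at EVERY finite place `v` —
✔ `forall_localMu_eq_of_equiv_of_localSeparation` with the local separation supplied by `localMu_eq_of_nonempty_equiv_localTypes`.
[cite: Liu2021, Def. 4.11 (l. 2086, 2092–2096), Thm. 4.18 (2) with proof l. 2270, App. D Lem. D.1 (1), (3) (l. 5229, 5233); FlathCorvallis1979, Theorem 3 (uniqueness clause)] -/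
theorem forall_localMu_eq_of_equiv_of_lemD1AsPrintedI (hV : TV.IsSymm) (hVd : IsUnit TV.det)
    (hJV : JV = TV.map (algebraMap F E))
    (hn : 3 ≤ n) {ι : Type} (aOf : ι → Fˣ) (χOf : ι → Chi F E c)
    (𝓢Of : ∀ i, LocalSplitting.FinLocalSplittings F E c n hcδ hδ hd (gram F e TV (TW F (aOf i))) (isSymm_gram F e hV (isSymm_TW F (aOf i)))
      (reindex_kronecker_eq_gram_map F E e hJV (JW_eq F E (aOf i))))
    (μOf : ι → ∀ v : HeightOneSpectrum (𝓞 F), (LocalRing E v)ˣ →* ℂˣ) (hμn : ∀ i v x, ‖((μOf i v x : ℂˣ) : ℂ)‖ = 1)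
    (hμc : ∀ i v, Continuous fun x => ((μOf i v x : ℂˣ) : ℂ))
    (hμF : ∀ (i : ι) (v : HeightOneSpectrum (𝓞 F)) (t : (v.adicCompletion F)ˣ),
      μOf i v (Units.map (algebraMap (v.adicCompletion F) (LocalRing E v)).toMonoidHom t) = 1 ↔
        ∃ x : (LocalRing E v)ˣ, (x : LocalRing E v) * conjLocal E c v x = algebraMap (v.adicCompletion F) (LocalRing E v) t)
    {sOf : ∀ (i : ι) (a : Fˣ), UnitaryGroup.adelicPair F E c N 1 JV (JW F E a) →* adelicMpCont F (Fin n) (adelicGram F e TV (TW F a))}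
    (hsOf : ∀ (i : ι) (a : Fˣ), (splittingDatum F E c N 1 e JV (JW F E a) hcδ hδ hd hV (isSymm_TW F a) hVd (isUnit_det_TW F a) hJV
      (JW_eq F E a)).IsCompatible (sOf i a))
    (hfacOf : ∀ i, (pairSmall₁ F E c N 1 e JV (JW F E (aOf i)) (sOf i (aOf i))).comp (finPairToAdelic F E c N 1 JV (JW F E (aOf i))) =
      localRefSection F E c N 1 e JV (JW F E (aOf i)) hcδ hδ hd hV (isSymm_TW F (aOf i)) hJV (JW_eq F E (aOf i)) (𝓢Of i))
    (hD1 : ∀ i v, LemD1_1AsPrinted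
      (localLemD1Data F E c N e JV hcδ hδ hd hV hVd hJV (aOf i) (𝓢Of i) hn (μOf i) (hμn i) (hμc i) (hμF i) (χOf i).1
        (norm_chi_eq_one F E c (Algebra.IsQuadraticExtension.finrank_eq_two F E)
          (UnitaryGroup.algEquiv_ne_one_of_apply_eq_neg F E c hcδ hδ) (χOf i)) (χOf i).2.1 v))
    (hD3 : ∀ v, LemD1_3AsPrintedI (localIndexedFamilyAtV F E c N e JV hcδ hδ hd hV hVd hJV hn aOf χOf 𝓢Of μOf hμn hμc hμF v))
    {G : Type*} [Group G] {ι' : G →* UnitaryGroup.finAdelic F E c N JV} (hι : Function.Surjective ι') (i j : ι)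
    (hnt : Nontrivial (omegaAtLine F E c N e JV hcδ hδ hd hV hVd hJV (hsOf i) (aOf i) (χOf i)))
    (hst : ∃ f : omegaAtLine F E c N e JV hcδ hδ hd hV hVd hJV (hsOf i) (aOf i) (χOf i) ≃ₗ[ℂ]
        omegaAtLine F E c N e JV hcδ hδ hd hV hVd hJV (hsOf j) (aOf j) (χOf j),
      ∀ (g : G) (x : omegaAtLine F E c N e JV hcδ hδ hd hV hVd hJV (hsOf i) (aOf i) (χOf i)),
        f (rhoAtLine F E c N e JV hcδ hδ hd hV hVd hJV (hsOf i) ι' (aOf i) (χOf i) g x) =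
          rhoAtLine F E c N e JV hcδ hδ hd hV hVd hJV (hsOf j) ι' (aOf j) (χOf j) g (f x))
    (v : HeightOneSpectrum (𝓞 F)) : μOf i v = μOf j v :=
  forall_localMu_eq_of_equiv_of_localSeparation F E c N e JV hcδ hδ hd hV hVd hJV (hsOf i) (hsOf j) (aOf i) (χOf i) (𝓢Of i) (aOf j)
    (χOf j) (𝓢Of j) (hfacOf i) (hfacOf j) hn (μOf i) (hμn i) (hμc i) (hμF i) (μOf j) (hμn j) (hμc j) (hμF j) (hD1 i) (hD1 j) hι
    (fun w hw => localMu_eq_of_nonempty_equiv_localTypes F E c N e JV hcδ hδ hd hV hVd hJV hn aOf χOf 𝓢Of μOf hμn hμc hμF hD3 w i j hw)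
    hnt hst v

/-- **THE CROSS-`μ` SEPARATION `hμsep`, local half, from [Liu2021, App. D Lem. D.1 (1), (3)] AS PRINTED read on the INDEXED FAMILY ONLY** (no
pair-form cite): Lem. D.1, first sentence + (1), at every member of `localIndexedFamilyAtV … v` (`hD1V`) makes the local types irreducible
(`isIrreducible_localType_of_lemD1AsPrintedAtV`), item (3) (`hD3`) separates them; the restriction step is ✔
`nonempty_equiv_localTypes_of_equivId_of_isIrreducible`.  Same conclusion: `μ_{i,v} = μ_{j,v}` at every finite place `v`.
[cite: Liu2021, Def. 4.11 (l. 2086, 2092–2096), Thm. 4.18 (2) with proof l. 2270, App. D Lem. D.1 (1), (3) (l. 5229, 5233); FlathCorvallis1979, Theorem 3 (uniqueness clause)] -/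
theorem forall_localMu_eq_of_equiv_of_lemD1AsPrintedAtV (hV : TV.IsSymm) (hVd : IsUnit TV.det)
    (hJV : JV = TV.map (algebraMap F E))
    (hn : 3 ≤ n) {ι : Type} (aOf : ι → Fˣ) (χOf : ι → Chi F E c)
    (𝓢Of : ∀ i, LocalSplitting.FinLocalSplittings F E c n hcδ hδ hd (gram F e TV (TW F (aOf i))) (isSymm_gram F e hV (isSymm_TW F (aOf i)))
      (reindex_kronecker_eq_gram_map F E e hJV (JW_eq F E (aOf i))))
    (μOf : ι → ∀ v : HeightOneSpectrum (𝓞 F), (LocalRing E v)ˣ →* ℂˣ) (hμn : ∀ i v x, ‖((μOf i v x : ℂˣ) : ℂ)‖ = 1)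
    (hμc : ∀ i v, Continuous fun x => ((μOf i v x : ℂˣ) : ℂ))
    (hμF : ∀ (i : ι) (v : HeightOneSpectrum (𝓞 F)) (t : (v.adicCompletion F)ˣ),
      μOf i v (Units.map (algebraMap (v.adicCompletion F) (LocalRing E v)).toMonoidHom t) = 1 ↔
        ∃ x : (LocalRing E v)ˣ, (x : LocalRing E v) * conjLocal E c v x = algebraMap (v.adicCompletion F) (LocalRing E v) t)
    {sOf : ∀ (i : ι) (a : Fˣ), UnitaryGroup.adelicPair F E c N 1 JV (JW F E a) →* adelicMpCont F (Fin n) (adelicGram F e TV (TW F a))}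
    (hsOf : ∀ (i : ι) (a : Fˣ), (splittingDatum F E c N 1 e JV (JW F E a) hcδ hδ hd hV (isSymm_TW F a) hVd (isUnit_det_TW F a) hJV
      (JW_eq F E a)).IsCompatible (sOf i a))
    (hfacOf : ∀ i, (pairSmall₁ F E c N 1 e JV (JW F E (aOf i)) (sOf i (aOf i))).comp (finPairToAdelic F E c N 1 JV (JW F E (aOf i))) =
      localRefSection F E c N 1 e JV (JW F E (aOf i)) hcδ hδ hd hV (isSymm_TW F (aOf i)) hJV (JW_eq F E (aOf i)) (𝓢Of i))
    (hD3 : ∀ v, LemD1_3AsPrintedI (localIndexedFamilyAtV F E c N e JV hcδ hδ hd hV hVd hJV hn aOf χOf 𝓢Of μOf hμn hμc hμF v))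
    {G : Type*} [Group G] {ι' : G →* UnitaryGroup.finAdelic F E c N JV} (hι : Function.Surjective ι')
    (hD1V : ∀ v, (localIndexedFamilyAtV F E c N e JV hcδ hδ hd hV hVd hJV hn aOf χOf 𝓢Of μOf hμn hμc hμF v).Item1AsPrinted) (i j : ι)
    (hnt : Nontrivial (omegaAtLine F E c N e JV hcδ hδ hd hV hVd hJV (hsOf i) (aOf i) (χOf i)))
    (hst : ∃ f : omegaAtLine F E c N e JV hcδ hδ hd hV hVd hJV (hsOf i) (aOf i) (χOf i) ≃ₗ[ℂ]
        omegaAtLine F E c N e JV hcδ hδ hd hV hVd hJV (hsOf j) (aOf j) (χOf j),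
      ∀ (g : G) (x : omegaAtLine F E c N e JV hcδ hδ hd hV hVd hJV (hsOf i) (aOf i) (χOf i)),
        f (rhoAtLine F E c N e JV hcδ hδ hd hV hVd hJV (hsOf i) ι' (aOf i) (χOf i) g x) =
          rhoAtLine F E c N e JV hcδ hδ hd hV hVd hJV (hsOf j) ι' (aOf j) (χOf j) g (f x))
    (v : HeightOneSpectrum (𝓞 F)) : μOf i v = μOf j v := by
  haveI := hnt
  obtain ⟨Eq⟩ := nonempty_equivId_of_equiv F E c N e JV hcδ hδ hd hV hVd hJV (hsOf i) (hsOf j) (aOf i) (aOf j) (χOf i) (χOf j) hι hst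
  haveI := isIrreducible_localType_of_lemD1AsPrintedAtV F E c N e JV hcδ hδ hd hV hVd hJV (aOf i) (𝓢Of i) hn (μOf i) (hμn i) (hμc i)
    (hμF i) (χOf i) v (hD1V v i)
  haveI := isIrreducible_localType_of_lemD1AsPrintedAtV F E c N e JV hcδ hδ hd hV hVd hJV (aOf j) (𝓢Of j) hn (μOf j) (hμn j) (hμc j)
    (hμF j) (χOf j) v (hD1V v j)
  exact localMu_eq_of_nonempty_equiv_localTypes F E c N e JV hcδ hδ hd hV hVd hJV hn aOf χOf 𝓢Of μOf hμn hμc hμF hD3 v i j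
    (nonempty_equiv_localTypes_of_equivId_of_isIrreducible F E c N e JV hcδ hδ hd hV hVd hJV (hsOf i) (hsOf j) (aOf i) (χOf i) (𝓢Of i)
      (aOf j) (χOf j) (𝓢Of j) (hfacOf i) (hfacOf j) hn Eq v)

end Indexed

end Literature.NumberTheory.Automorphic.Liu2021.Def411WeilCarriers

end
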